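import Mathlib
import Literature.Computability.AlgebraicComplexity.OrbitClosureProofs
import Literature.NumberTheory.DiophantineGeometry.SchurWeylPlethysm
import Summits.ValiantsHypothesis.ValiantsHypothesis.Theorems.CutBites.Negative.LeftSLInvariantsDetPow
import Summits.ValiantsHypothesis.ValiantsHypothesis.Theorems.ValuativeGCTValuativeFlipCyclicPencilAdjugate

/-!
# Linear-entry determinants: blocks, products, and the small-body test forms of `Δ(det_m)`

Crux `ValuativeGCT.ValuativeFlip` (stmt-ValiantsHypothesis-12624), wall-breaker axis D
("det-orbit-closure multiplicity bounds for `detCensus`", seat k3 gen 1/2).  First file of the chain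
proving the NO-SMALL-BODY EQUATIONS theorem for the determinant orbit closure
(`K_m(λ*) = a_λ(δ[m])` whenever the body `|λ̄| = mδ - λ₁` is at most `m`, file
`ValuativeGCTValuativeFlipNoSmallBodyEquations`), which the tail of the crux (`TailFlip`, idea card
`Cruxes/TailFlip/Ideas/mixed-discriminant-dictionary.md`, first lemma `NoSmallBodyEquations`) asks for.

This file supplies the TEST POINTS of `Δ(det_m)` used there: for a scalar family `t`, block sizes
`a_j ≥ 1` with `Σ a_j ≤ m` and monomials `x^{γ_j}` of degree `a_j`,

  `G_t = X_u^{m - Σ a_j} · ∏_j (X_u^{a_j} + t_j · x^{γ_j})`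

is the determinant of an `m × m` matrix of LINEAR forms — block diagonal with a scalar block
`X_u · 1` and, for each `j`, the cyclic pencil `X_u · 1 − cshift⟦w⟧` of
`ValuativeGCTValuativeFlipCyclicPencilAdjugate` (`det = X_u^{a_j} − ∏ wᵢ`, weights the variables of
`x^{γ_j}`, one of them multiplied by `-t_j`) — hence a linear substitution of `det_m`, hence a
point of `End · det_m ⊆ Δ(det_m)` (`endOrbit_subset_orbitClosure_holds`).

Contents: degree-one forms are linear combinations of variables
(`nsb_eq_sum_coeff_smul_X_of_isHomogeneous_one`); the determinant of an `m × m` matrix of linear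
forms in the `m²` matrix variables lies in `Δ(det_m)` (`nsb_det_mem_orbitClosure_detFormLex`, any
index type of cardinality `m`); block calculus for "`f` is the determinant of an `n × n` matrix of
linear forms" (products `nsb_linDet_mul`, finite products `nsb_linDet_prod`, powers of a variable
`nsb_linDet_X_pow`, the cyclic monomial block `nsb_linDet_X_pow_add_smul_monomial`); and the test
forms (`nsb_testForm_mem_orbitClosure_detFormLex`).  Everything is elementary and definition-free
[folklore].
-/

-- `Summit.ValiantsHypothesis.ValiantsHypothesis.…` is the tree's mandated single-conjunct layout (Sub = Summit).
set_option linter.dupNamespace false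

namespace Summit.ValiantsHypothesis.ValiantsHypothesis.Theorems.ValuativeFlip

open MvPolynomial
open Literature.NumberTheory.DiophantineGeometry Literature.Computability.AlgebraicComplexity
open scoped BigOperators Matrix

noncomputable section

/-! ## Degree-one forms and linear-entry determinants in `Δ(det_m)` -/

section LinearEntries

variable {σ : Type*}

/-- A form of degree one is the linear combination `Σ_l coeff_{e_l}(g) · X_l` of the variables.
[folklore] -/
theorem nsb_eq_sum_coeff_smul_X_of_isHomogeneous_one [Fintype σ] [DecidableEq σ]
    {g : MvPolynomial σ ℂ} (hg : g.IsHomogeneous 1) :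
    g = ∑ l : σ, coeff (Finsupp.single l 1) g • (X l : MvPolynomial σ ℂ) := by
  classical
  refine MvPolynomial.ext _ _ fun d => ?_
  rw [coeff_sum]
  simp only [coeff_smul, coeff_X, smul_eq_mul, mul_ite, mul_one, mul_zero]
  by_cases hd : d.degree = 1
  · have hmem : d ∈ {d : σ →₀ ℕ | d.degree = 1} := hd
    rw [← Finsupp.range_single_one] at hmem
    obtain ⟨l, rfl⟩ := hmem
    rw [Finset.sum_eq_single l]
    · rw [if_pos rfl]
    · intro b _ hb
      rw [if_neg]
      intro h
      exact hb (Finsupp.single_left_injective one_ne_zero h)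
    · intro h
      exact absurd (Finset.mem_univ l) h
  · rw [hg.coeff_eq_zero hd]
    symm
    refine Finset.sum_eq_zero fun l _ => ?_
    rw [if_neg]
    intro h
    apply hd
    rw [← h, Finsupp.degree_single]

/-- **Linear-entry determinants are points of `Δ(det_m)`.**  The determinant of an `m × m` matrix
(any index type of cardinality `m`) whose entries are linear forms in the matrix variables
`MatIdx m` is a linear substitution of `det_m`, hence lies in `End · det_m ⊆ Δ(det_m)`. [folklore] -/
theorem nsb_det_mem_orbitClosure_detFormLex {m : ℕ} {ι : Type*} [Fintype ι] [DecidableEq ι]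
    (e : ι ≃ Fin m) (N : Matrix ι ι (MvPolynomial (MatIdx m) ℂ))
    (hN : ∀ a b, (N a b).IsHomogeneous 1) :
    N.det ∈ orbitClosure (detFormLex ℂ m) := by
  classical
  -- reindex to `Fin m`
  set N' : Matrix (Fin m) (Fin m) (MvPolynomial (MatIdx m) ℂ) := Matrix.reindex e e N with hN'
  have hdet : N.det = N'.det := by rw [hN', Matrix.det_reindex_self]
  have hN'h : ∀ a b, (N' a b).IsHomogeneous 1 := fun a b => by
    rw [hN', Matrix.reindex_apply, Matrix.submatrix_apply]
    exact hN _ _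
  -- the substitution matrix
  set A : Matrix (MatIdx m) (MatIdx m) ℂ :=
    fun l p => coeff (Finsupp.single l 1) (N' (ofLex p).1 (ofLex p).2) with hA
  have key : linSubst (MatIdx m) ℂ A (detFormLex ℂ m) = N'.det := by
    rw [CutBites.Negative.detFormLex_eq_det_of, AlgHom.map_det]
    congr 1
    ext a b
    rw [AlgHom.mapMatrix_apply, Matrix.map_apply, Matrix.of_apply, linSubst_X,
      nsb_eq_sum_coeff_smul_X_of_isHomogeneous_one (hN'h a b)]
    simp only [hA, ofLex_toLex]
  rw [hdet, ← key]
  exact endOrbit_subset_orbitClosure_holds _ ⟨A, rfl⟩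

end LinearEntries

/-! ## Block calculus for linear-entry determinants

"`f` is an `n × n` linear-entry determinant" is written out as
`∃ N : Matrix (Fin n) (Fin n) (MvPolynomial σ ℂ), (∀ a b, (N a b).IsHomogeneous 1) ∧ N.det = f`
(no definition is introduced). -/

section Blocks

variable {σ : Type*}

/-- Products: block-diagonal assembly (`fromBlocks`, reindexed along `finSumFinEquiv`). [folklore] -/
theorem nsb_linDet_mul {n₁ n₂ : ℕ} {f g : MvPolynomial σ ℂ}
    (hf : ∃ N : Matrix (Fin n₁) (Fin n₁) (MvPolynomial σ ℂ), (∀ a b, (N a b).IsHomogeneous 1) ∧ N.det = f)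
    (hg : ∃ N : Matrix (Fin n₂) (Fin n₂) (MvPolynomial σ ℂ), (∀ a b, (N a b).IsHomogeneous 1) ∧ N.det = g) :
    ∃ N : Matrix (Fin (n₁ + n₂)) (Fin (n₁ + n₂)) (MvPolynomial σ ℂ),
      (∀ a b, (N a b).IsHomogeneous 1) ∧ N.det = f * g := by
  obtain ⟨N₁, hN₁, rfl⟩ := hf
  obtain ⟨N₂, hN₂, rfl⟩ := hg
  refine ⟨Matrix.reindex finSumFinEquiv finSumFinEquiv (Matrix.fromBlocks N₁ 0 0 N₂), ?_, ?_⟩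
  · intro a b
    rw [Matrix.reindex_apply, Matrix.submatrix_apply]
    rcases finSumFinEquiv.symm a with a₁ | a₂ <;> rcases finSumFinEquiv.symm b with b₁ | b₂
    · rw [Matrix.fromBlocks_apply₁₁]; exact hN₁ _ _
    · rw [Matrix.fromBlocks_apply₁₂]; exact isHomogeneous_zero _ _ 1
    · rw [Matrix.fromBlocks_apply₂₁]; exact isHomogeneous_zero _ _ 1
    · rw [Matrix.fromBlocks_apply₂₂]; exact hN₂ _ _
  · rw [Matrix.det_reindex_self, Matrix.det_fromBlocks_zero₂₁]

/-- The empty determinant: `1` is a `0 × 0` linear-entry determinant. [folklore] -/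
theorem nsb_linDet_one :
    ∃ N : Matrix (Fin 0) (Fin 0) (MvPolynomial σ ℂ), (∀ a b, (N a b).IsHomogeneous 1) ∧ N.det = 1 :=
  ⟨0, fun a => Fin.elim0 a, by rw [Matrix.det_isEmpty]⟩

/-- Finite products of linear-entry determinants are linear-entry determinants (sizes add). [folklore] -/
theorem nsb_linDet_prod {ι : Type*} (s : Finset ι) (n : ι → ℕ) (f : ι → MvPolynomial σ ℂ)
    (h : ∀ i ∈ s, ∃ N : Matrix (Fin (n i)) (Fin (n i)) (MvPolynomial σ ℂ),
      (∀ a b, (N a b).IsHomogeneous 1) ∧ N.det = f i) :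
    ∃ N : Matrix (Fin (∑ i ∈ s, n i)) (Fin (∑ i ∈ s, n i)) (MvPolynomial σ ℂ),
      (∀ a b, (N a b).IsHomogeneous 1) ∧ N.det = ∏ i ∈ s, f i := by
  classical
  induction s using Finset.induction_on with
  | empty =>
    rw [Finset.sum_empty, Finset.prod_empty]
    exact nsb_linDet_one
  | @insert i s hi ih =>
    rw [Finset.sum_insert hi, Finset.prod_insert hi]
    exact nsb_linDet_mul (h i (Finset.mem_insert_self i s))
      (ih fun i' hi' => h i' (Finset.mem_insert_of_mem hi'))

/-- Powers of a variable: `X_u ^ n = det (X_u · 1)`. [folklore] -/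
theorem nsb_linDet_X_pow (u : σ) (n : ℕ) :
    ∃ N : Matrix (Fin n) (Fin n) (MvPolynomial σ ℂ), (∀ a b, (N a b).IsHomogeneous 1) ∧ N.det = X u ^ n := by
  refine ⟨(X u : MvPolynomial σ ℂ) • (1 : Matrix (Fin n) (Fin n) (MvPolynomial σ ℂ)), ?_, ?_⟩
  · intro a b
    rw [Matrix.smul_apply, Matrix.one_apply, smul_eq_mul, mul_ite, mul_one, mul_zero]
    split_ifs
    · exact isHomogeneous_X ℂ u
    · exact isHomogeneous_zero _ _ 1
  · rw [Matrix.det_smul, Matrix.det_one, mul_one, Fintype.card_fin]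

open Fin.CommRing in  -- `Fin (n+1)` as a commutative ring (scoped Mathlib instance): cyclic index arithmetic
/-- **The cyclic monomial block.**  For a monomial `x^γ` of degree `n + 1 ≥ 1`, a variable `u` and
a scalar `t`, the form `X_u^{n+1} + t · x^γ` is an `(n+1) × (n+1)` linear-entry determinant: the
cyclic pencil `X_u · 1 − cshift⟦w⟧` of `ValuativeGCTValuativeFlipCyclicPencilAdjugate`, the weights
`w` listing the variables of `x^γ` with multiplicity and the last one multiplied by `-t`
(`det = X_u^{n+1} − ∏ wᵢ = X_u^{n+1} + t · x^γ`). [folklore] -/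
theorem nsb_linDet_X_pow_add_smul_monomial [DecidableEq σ] (u : σ) (t : ℂ) {n : ℕ}
    (γ : σ →₀ ℕ) (hγ : γ.degree = n + 1) :
    ∃ N : Matrix (Fin (n + 1)) (Fin (n + 1)) (MvPolynomial σ ℂ),
      (∀ a b, (N a b).IsHomogeneous 1) ∧ N.det = X u ^ (n + 1) + t • monomial γ 1 := by
  classical
  -- enumerate the variables of `x^γ` with multiplicity
  set L : List σ := γ.toMultiset.toList with hL
  have hlen : L.length = n + 1 := by
    rw [hL, Multiset.length_toList, Finsupp.card_toMultiset, ← hγ, Finsupp.degree]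
    rfl
  set y : Fin (n + 1) → σ := fun i => L.get (Fin.cast hlen.symm i) with hy
  have hprod : ∏ i : Fin (n + 1), (X (y i) : MvPolynomial σ ℂ) = monomial γ 1 := by
    have h1 : ∏ i : Fin (n + 1), (X (y i) : MvPolynomial σ ℂ) = (L.map (X : σ → MvPolynomial σ ℂ)).prod := by
      rw [← List.prod_ofFn]
      congr 1
      apply List.ext_getElem
      · rw [List.length_ofFn, List.length_map, hlen]
      · intro i h₁ h₂
        simp only [List.getElem_ofFn, List.getElem_map, hy, List.get_eq_getElem, Fin.val_cast]
    rw [h1, hL, ← Multiset.prod_coe, ← Multiset.map_coe, Multiset.coe_toList, Finsupp.toMultiset_map,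
      Finsupp.prod_toMultiset, Finsupp.prod_mapDomain_index_inj (X_injective (σ := σ) (R := ℂ))]
    exact prod_X_pow_eq_monomial
  -- the weights
  set w : Fin (n + 1) → MvPolynomial σ ℂ :=
    fun i => if i = Fin.last n then (-t) • X (y i) else X (y i) with hw
  have hwprod : ∏ i, w i = (-t) • monomial γ 1 := by
    have hlast : w (Fin.last n) = (-t) • X (y (Fin.last n)) := by rw [hw]; exact if_pos rfl
    have hcs : ∀ i : Fin n, w (Fin.castSucc i) = X (y (Fin.castSucc i)) := fun i => by
      rw [hw]; exact if_neg (Fin.castSucc_ne_last i)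
    rw [← hprod, Fin.prod_univ_castSucc, Fin.prod_univ_castSucc, hlast,
      Finset.prod_congr rfl (fun i _ => hcs i), mul_smul_comm]
  refine ⟨(X u : MvPolynomial σ ℂ) • (1 : Matrix (Fin (n + 1)) (Fin (n + 1)) (MvPolynomial σ ℂ)) -
      Matrix.of (fun i j : Fin (n + 1) => if j = i + 1 then w i else 0), ?_, ?_⟩
  · intro a b
    rw [smul_one_sub_cyclicShift_apply]
    refine IsHomogeneous.sub ?_ ?_
    · split_ifs
      · exact isHomogeneous_X ℂ u
      · exact isHomogeneous_zero _ _ 1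
    · split_ifs
      · rw [hw]
        dsimp only
        split_ifs
        · rw [smul_eq_C_mul]; exact isHomogeneous_C_mul_X _ _
        · exact isHomogeneous_X ℂ _
      · exact isHomogeneous_zero _ _ 1
  · rw [det_smul_one_sub_cyclicShift, hwprod, sub_eq_add_neg, ← neg_smul, neg_neg]

/-- **The small-body test forms are linear-entry determinants.**  For a variable `u`, a finite set
`J` of blocks with sizes `a j ≥ 1`, monomials `x^{γ j}` of degree `a j` and scalars `t j`, and
`Σ_{j ∈ J} a j ≤ m`, the form `X_u^{m - Σ a} · ∏_{j ∈ J} (X_u^{a j} + t j · x^{γ j})` is an `m × m`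
linear-entry determinant (up to the index cast `Fin ((m - Σa) + Σa) ≃ Fin m`). [folklore] -/
theorem nsb_linDet_testForm [DecidableEq σ] {ι : Type*} (J : Finset ι) (u : σ) (a : ι → ℕ)
    (γ : ι → σ →₀ ℕ) (t : ι → ℂ) (ha : ∀ j ∈ J, 1 ≤ a j) (hγ : ∀ j ∈ J, (γ j).degree = a j) (m : ℕ) :
    ∃ N : Matrix (Fin ((m - ∑ j ∈ J, a j) + ∑ j ∈ J, a j)) (Fin ((m - ∑ j ∈ J, a j) + ∑ j ∈ J, a j)) (MvPolynomial σ ℂ),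
      (∀ a b, (N a b).IsHomogeneous 1) ∧
      N.det = X u ^ (m - ∑ j ∈ J, a j) * ∏ j ∈ J, (X u ^ (a j) + t j • monomial (γ j) 1) := by
  refine nsb_linDet_mul (nsb_linDet_X_pow u _) (nsb_linDet_prod J a _ fun j hj => ?_)
  obtain ⟨n, hn⟩ : ∃ n, a j = n + 1 := ⟨a j - 1, (Nat.sub_add_cancel (ha j hj)).symm⟩
  rw [hn]
  exact nsb_linDet_X_pow_add_smul_monomial u (t j) (γ j) (by rw [hγ j hj, hn])

end Blocks

/-! ## The test forms lie in `Δ(det_m)` -/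

section TestForms

/-- **Small-body test forms are points of `Δ(det_m)`.**  In the matrix variables `MatIdx m`: for a
variable `u`, blocks `j ∈ J` with sizes `a j ≥ 1` summing to at most `m`, monomials `x^{γ j}` of
degree `a j` and scalars `t j`,
`X_u^{m - Σ a} · ∏_{j ∈ J} (X_u^{a j} + t j · x^{γ j}) ∈ Δ(det_m)` — it is the determinant of an
`m × m` matrix of linear forms (`nsb_linDet_testForm`, `nsb_det_mem_orbitClosure_detFormLex`). [folklore] -/
theorem nsb_testForm_mem_orbitClosure_detFormLex {m : ℕ} {ι : Type*} (J : Finset ι) (u : MatIdx m)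
    (a : ι → ℕ) (γ : ι → MatIdx m →₀ ℕ) (t : ι → ℂ) (ha : ∀ j ∈ J, 1 ≤ a j)
    (hγ : ∀ j ∈ J, (γ j).degree = a j) (hm : ∑ j ∈ J, a j ≤ m) :
    X u ^ (m - ∑ j ∈ J, a j) * ∏ j ∈ J, (X u ^ (a j) + t j • monomial (γ j) 1) ∈
      orbitClosure (detFormLex ℂ m) := by
  classical
  obtain ⟨N, hN, hdet⟩ := nsb_linDet_testForm J u a γ t ha hγ m
  rw [← hdet]
  exact nsb_det_mem_orbitClosure_detFormLex (finCongr (Nat.sub_add_cancel hm)) N hN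

end TestForms

end

end Summit.ValiantsHypothesis.ValiantsHypothesis.Theorems.ValuativeFlip
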